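import Summits.NavierStokesRegularity.NavierStokesRegularity.Theorems.ScenarioCensusTemporalSpectrumQuasi
import Summits.NavierStokesRegularity.NavierStokesRegularity.Theorems.ScenarioCensusModeRankShell
import HarnessLib

/-!
# LINE «temporal-spectrum» port, part 10/12: §Q (c) — `q_group_tendsto`, `Row_A1qx`

Re-homed for the scenario census (typer seat ns-census-typer-1 g8; the cells A1ex / A1po are MEMBERS OF RECORD «DECIDED IN KERNEL IN FILES» of row A1apT since census
v1.69 and A1jb / A1cs / A1qx / A1cx since v1.71 (critic idea-crit-3 g6 PASS — no price 20:33:05Z, RE-STAMPs REV 2 → REV 3 → REV 4 22:13:50Z; ref ns-census-ref g8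
PRE-CHECK ✓ §13.14 item 11 + items 19/20; lit §21.21 / §21.24 (a)); this port makes them TREE-decided): VERBATIM PORT of ns-idea-2 LINE g12-2 «temporal-spectrum»
REV 4, `pub/ideators/ns-idea-2/lines/temporal-spectrum/line-temporal-spectrum.lean` sha16 f2331f3a0765e1d4 (3431 l., lean check rc 0, 0 sorry), split for the
400-line rule into twelve parts `ScenarioCensusTemporalSpectrum{∅, Exponential, Oscillatory, OscillatoryRow, Jordan, Complex, ComplexDecay, ComplexRow, Quasi, QuasiGroup,
QuasiRow, Head}` (chain imports).  Lean text VERBATIM in namespace `…Theorems.ScenarioCensus.TemporalSpectrum` (the line's `…Lines.TemporalSpectrum` re-homed);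
port edits: the two `local notation "E3"` lines → one `abbrev E3` at namespace level and the bracket lines `section Rows` / `end Rows` dropped (no `variable`s
there; typer lint: no notation in port files), `@[conjecture]` on the OPEN head `Row_A1qp` (typed only), twenty-one one-line docstrings added (gate lint); the
lemmas the line shares VERBATIM with «mode-rank» / «floquet-meter» (§B spatial Liouville lemmas, the instrument `vortB` / `vortB_sum_sum`, the gauge
`tendsto_slice_atBot` / `eq_zero_of_curl_slice_const`, `laplacian_zero_apply`, `norm_curl_le_four_mul`) are taken BY NAME from those landed ports (listed
below); `tendsto_typeI_bound` (twin of a landed tree lemma in a module the farm does not build) is not re-declared and its four uses carry the one-line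
Mathlib proof inline (proof text only).  Statements untouched.

No census VALUE is moved here (row A1apT keeps its value; the members become TREE-decided by name); NS regularity is NOT proved; (L′) ⟨10661⟩ is
untouched; no summit statement is proved by this file. Lemmas that restate already-landed tree declarations are taken BY NAME (gate lint `dedup.landed`): `apply_eq_apply_of_harmonic_bounded` = `ModeRank.apply_eq_apply_of_harmonic_bounded`, `apply_eq_apply_of_curl_const` = `ModeRank.apply_eq_apply_of_curl_const`, `nonpos_of_laplacian_eq_mul` = `ModeRank.nonpos_of_laplacian_eq_mul`, `eq_zero_of_laplacian_eq_smul_of_pos` = `ModeRank.eq_zero_of_laplacian_eq_smul_of_pos`, `vortB` = `ModeRank.vortB`, `vortB_sum_sum` = `ModeRank.vortB_sum_sum`, `tendsto_slice_atBot` = `ModeRank.tendsto_slice_atBot`, `eq_zero_of_curl_slice_const` = `ModeRank.eq_zero_of_curl_slice_const`, `laplacian_zero_apply` = `ModeRank.laplacian_zero_fun`, `norm_curl_le_four_mul` = `FloquetMeter.norm_curl_le_four_mul`.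
-/

-- the summit and its single problem share the name `NavierStokesRegularity` (D-0017 nested layout)
set_option linter.dupNamespace false

noncomputable section

open Set Function Filter Topology

namespace Summit.NavierStokesRegularity.NavierStokesRegularity.Theorems.ScenarioCensus.TemporalSpectrum

open Literature.Analysis Literature.Analysis.FluidPDE InnerProductSpace
open Summit.NavierStokesRegularity.NavierStokesRegularity.Theorems (vorticity_eq_deriv_of_typeI)
open scoped Laplacian InnerProductSpace RealInnerProductSpace ContDiff

/-- **Step 3a of Row A1qx: the linear group of the smallest vorticity-carrying real part tends to
zero**, in quasi-polynomial shape with the Jordan coupling moved onto `t^m` by reindexing. -/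
theorem q_group_tendsto {n d : ℕ} {a b : Fin n → ℝ} {ψ χ : Fin n → ℕ → E3 → E3}
    (hψd : ∀ k m, d ≤ m → ψ k m = 0) (hχd : ∀ k m, d ≤ m → χ k m = 0)
    (hdec : ∀ k, a k ≤ 0 → ∀ m < d, (∀ x, ψ k m x = 0) ∧ (b k ≠ 0 → ∀ x, χ k m x = 0)) {r : ℝ}
    (hlow : ∀ k, a k < r → ∀ m < d, curl (ψ k m) = 0 ∧ (b k ≠ 0 → curl (χ k m) = 0))
    (hE : ∀ t < 0, ∀ x,
      ∑ p, qc' d a b t p • curl (qΦ d ψ χ p) x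
        + ∑ p, ∑ q, (qc d a b t p * qc d a b t q) • ModeRank.vortB (qΦ d ψ χ p) (curl (qΦ d ψ χ q)) x
        - ∑ p, qc d a b t p • (Δ (curl (qΦ d ψ χ p))) x = 0) (x : E3) :
    Tendsto (fun t : ℝ => ∑ k ∈ Finset.univ.filter (fun k => a k = r), ∑ m ∈ Finset.range d,
      t ^ m • (Real.cos (b k * t) • qX a b ψ χ x k m + Real.sin (b k * t) • qY a b ψ χ x k m))
      atBot (𝓝 0) := by
  classical
  -- invisible modes
  have hqc0 : ∀ k (m : Fin d), b k = 0 → ∀ s, qc d a b s (Sum.inr k, m) = 0 := by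
    intro k m hk s; simp [qc_apply, csT_inr, hk]
  have hqc'0 : ∀ k (m : Fin d), b k = 0 → ∀ s, qc' d a b s (Sum.inr k, m) = 0 := by
    intro k m hk s; simp [qc'_apply, csT_inr, csD_inr, hk]
  have hvel0 : ∀ p : (Fin n ⊕ Fin n) × Fin d, csν a p.1 ≤ 0 → ∀ s,
      qc d a b s p • qΦ d ψ χ p = 0 := by
    rintro ⟨k | k, m⟩ hk s
    · simp only [csν_inl] at hk
      have h0 : ψ k m = 0 := funext (hdec k hk m m.isLt).1
      rw [qΦ_inl, h0, smul_zero]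
    · simp only [csν_inr] at hk
      by_cases hbk : b k = 0
      · rw [hqc0 k m hbk, zero_smul]
      · have h0 : χ k m = 0 := funext ((hdec k hk m m.isLt).2 hbk)
        rw [qΦ_inr, h0, smul_zero]
  have hvor0 : ∀ p : (Fin n ⊕ Fin n) × Fin d, csν a p.1 < r → ∀ s,
      qc d a b s p • curl (qΦ d ψ χ p) = 0 := by
    rintro ⟨k | k, m⟩ hk s
    · simp only [csν_inl] at hk
      rw [qΦ_inl, (hlow k hk m m.isLt).1, smul_zero]
    · simp only [csν_inr] at hk
      by_cases hbk : b k = 0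
      · rw [hqc0 k m hbk, zero_smul]
      · rw [qΦ_inr, (hlow k hk m m.isLt).2 hbk, smul_zero]
  -- the weighted linear terms
  set f : (Fin n ⊕ Fin n) × Fin d → ℝ → E3 := fun p t => Real.exp (-(r * t)) •
    (qc' d a b t p • curl (qΦ d ψ χ p) x - qc d a b t p • (Δ (curl (qΦ d ψ χ p))) x) with hf
  have hoff : ∀ p : (Fin n ⊕ Fin n) × Fin d, ¬ Sum.elim a a p.1 = r → Tendsto (f p) atBot (𝓝 0) := by
    rintro ⟨μ, m⟩ hp
    rcases lt_or_gt_of_ne hp with hlt | hgt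
    · -- an invisible vorticity mode
      refine tendsto_const_nhds.congr fun t => ?_
      symm
      simp only [hf]
      rcases μ with k | k
      · simp only [Sum.elim_inl] at hlt
        rw [qΦ_inl, (hlow k hlt m m.isLt).1]
        simp [ModeRank.laplacian_zero_fun]
      · simp only [Sum.elim_inr] at hlt
        by_cases hbk : b k = 0
        · rw [hqc0 k m hbk, hqc'0 k m hbk]; simp
        · rw [qΦ_inr, (hlow k hlt m m.isLt).2 hbk]
          simp [ModeRank.laplacian_zero_fun]
    · -- decaying weights beat the polynomial
      have hε : 0 < csν a μ - r := sub_pos.2 hgt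
      have T1 := tendsto_expPoly_smul hε (m : ℕ) (fun t => csT b t μ) 1
        (fun t => abs_csT_le b t μ) (fun _ => csν a μ • curl (qΦ d ψ χ (μ, m)) x)
        ‖csν a μ • curl (qΦ d ψ χ (μ, m)) x‖ (fun _ => le_rfl)
      have T2 := tendsto_expPoly_smul hε ((m : ℕ) - 1) (fun t => csT b t μ) 1
        (fun t => abs_csT_le b t μ) (fun _ => ((m : ℕ) : ℝ) • curl (qΦ d ψ χ (μ, m)) x)
        ‖((m : ℕ) : ℝ) • curl (qΦ d ψ χ (μ, m)) x‖ (fun _ => le_rfl)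
      have T3 := tendsto_expPoly_smul hε (m : ℕ) (fun t => csD b t μ) |Sum.elim b b μ|
        (fun t => abs_csD_le b t μ) (fun _ => curl (qΦ d ψ χ (μ, m)) x)
        ‖curl (qΦ d ψ χ (μ, m)) x‖ (fun _ => le_rfl)
      have T4 := tendsto_expPoly_smul hε (m : ℕ) (fun t => csT b t μ) 1
        (fun t => abs_csT_le b t μ) (fun _ => (Δ (curl (qΦ d ψ χ (μ, m)))) x)
        ‖(Δ (curl (qΦ d ψ χ (μ, m)))) x‖ (fun _ => le_rfl)
      have T := ((T1.add T2).add T3).sub T4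
      rw [add_zero, add_zero, sub_zero] at T
      refine T.congr fun t => ?_
      simp only [hf, qc_apply, qc'_apply, smul_sub, smul_smul]
      rw [exp_weight_mul, exp_weight_mul]
      module
  -- the weighted quadratic remainder
  have hpair : ∀ p q : (Fin n ⊕ Fin n) × Fin d, Tendsto (fun t : ℝ => Real.exp (-(r * t)) •
      ((qc d a b t p * qc d a b t q) • ModeRank.vortB (qΦ d ψ χ p) (curl (qΦ d ψ χ q)) x)) atBot (𝓝 0) := by
    intro p q
    by_cases hpq : r < csν a p.1 + csν a q.1
    · have hε : 0 < csν a p.1 + csν a q.1 - r := sub_pos.2 hpq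
      have T := tendsto_expPoly_smul hε ((p.2 : ℕ) + (q.2 : ℕ)) (fun t => csT b t p.1 * csT b t q.1)
        1 (fun t => by
          rw [abs_mul]
          exact mul_le_one₀ (abs_csT_le b t p.1) (abs_nonneg _) (abs_csT_le b t q.1))
        (fun _ => ModeRank.vortB (qΦ d ψ χ p) (curl (qΦ d ψ χ q)) x) ‖ModeRank.vortB (qΦ d ψ χ p) (curl (qΦ d ψ χ q)) x‖
        (fun _ => le_rfl)
      refine T.congr fun t => ?_
      rw [smul_smul, qc_apply, qc_apply]
      congr 1
      rw [show (csν a p.1 + csν a q.1 - r) * t = -(r * t) + csν a p.1 * t + csν a q.1 * t by ring,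
        Real.exp_add, Real.exp_add, pow_add]
      ring
    · push Not at hpq
      refine tendsto_const_nhds.congr fun t => ?_
      symm
      rw [smul_eq_zero]
      right
      rcases le_or_gt (csν a p.1) 0 with hp | hp
      · have h0 := hvel0 p hp t
        by_cases hc : qc d a b t p = 0
        · rw [hc, zero_mul, zero_smul]
        · have hΦ0 : qΦ d ψ χ p = 0 := by
            have := congrArg (fun F => (qc d a b t p)⁻¹ • F) h0
            simpa only [smul_smul, inv_mul_cancel₀ hc, one_smul, smul_zero] using this
          rw [hΦ0, vortB_zero_left, smul_zero]
      · have hq : csν a q.1 < r := by linarith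
        have h0 := hvor0 q hq t
        by_cases hc : qc d a b t q = 0
        · rw [hc, mul_zero, zero_smul]
        · have hω0 : curl (qΦ d ψ χ q) = 0 := by
            have := congrArg (fun F => (qc d a b t q)⁻¹ • F) h0
            simpa only [smul_smul, inv_mul_cancel₀ hc, one_smul, smul_zero] using this
          rw [hω0, vortB_zero_right, smul_zero]
  have hQ : Tendsto (fun t : ℝ => Real.exp (-(r * t)) •
      ∑ p, ∑ q, (qc d a b t p * qc d a b t q) • ModeRank.vortB (qΦ d ψ χ p) (curl (qΦ d ψ χ q)) x)
      atBot (𝓝 0) := by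
    have h0 : Tendsto (fun t : ℝ => ∑ p : (Fin n ⊕ Fin n) × Fin d, ∑ q : (Fin n ⊕ Fin n) × Fin d,
        Real.exp (-(r * t)) • ((qc d a b t p * qc d a b t q)
          • ModeRank.vortB (qΦ d ψ χ p) (curl (qΦ d ψ χ q)) x)) atBot (𝓝 0) := by
      rw [show (0 : E3) = ∑ p : (Fin n ⊕ Fin n) × Fin d, ∑ q : (Fin n ⊕ Fin n) × Fin d, (0 : E3)
        by simp]
      exact tendsto_finsetSum _ fun p _ => tendsto_finsetSum _ fun q _ => hpair p q
    refine h0.congr fun t => ?_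
    simp only [Finset.smul_sum]
  -- `L = -Q`
  have htot : Tendsto (fun t => ∑ p, f p t) atBot (𝓝 0) := by
    have hneg := hQ.neg
    rw [neg_zero] at hneg
    refine hneg.congr' ?_
    filter_upwards [Iio_mem_atBot (0 : ℝ)] with t ht
    have h := hE t ht x
    have hsum : ∑ p, f p t = Real.exp (-(r * t)) • (∑ p, qc' d a b t p • curl (qΦ d ψ χ p) x
        - ∑ p, qc d a b t p • (Δ (curl (qΦ d ψ χ p))) x) := by
      rw [← Finset.sum_sub_distrib, Finset.smul_sum]
    rw [hsum]
    generalize hA : (∑ p, qc' d a b t p • curl (qΦ d ψ χ p) x) = A at h ⊢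
    generalize hBq : (∑ p, ∑ q, (qc d a b t p * qc d a b t q)
      • ModeRank.vortB (qΦ d ψ χ p) (curl (qΦ d ψ χ q)) x) = Bq at h ⊢
    generalize hCl : (∑ p, qc d a b t p • (Δ (curl (qΦ d ψ χ p))) x) = Cl at h ⊢
    have hAC : A - Cl = -Bq := by rw [← sub_eq_zero, ← h]; abel
    rw [hAC, smul_neg]
  have G := tendsto_filter_of_tendsto (fun p : (Fin n ⊕ Fin n) × Fin d => Sum.elim a a p.1 = r)
    f hoff htot
  -- conversion to quasi-polynomial shape
  refine G.congr fun t => ?_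
  have e1 : ∑ p ∈ Finset.univ.filter (fun p : (Fin n ⊕ Fin n) × Fin d => Sum.elim a a p.1 = r),
      f p t = ∑ p ∈ Finset.univ.filter (fun p : (Fin n ⊕ Fin n) × Fin d => Sum.elim a a p.1 = r),
        ((r * (t ^ (p.2 : ℕ) * csT b t p.1)
            + (((p.2 : ℕ) : ℝ) * t ^ ((p.2 : ℕ) - 1) * csT b t p.1 + t ^ (p.2 : ℕ) * csD b t p.1))
            • curl (csΦ (fun k => ψ k p.2) (fun k => χ k p.2) p.1) x
          - (t ^ (p.2 : ℕ) * csT b t p.1)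
            • (Δ (curl (csΦ (fun k => ψ k p.2) (fun k => χ k p.2) p.1))) x) := by
    refine Finset.sum_congr rfl fun p hp => ?_
    have hp' : csν a p.1 = r := (Finset.mem_filter.1 hp).2
    simp only [hf, qc_apply, qc'_apply, smul_sub, smul_smul]
    rw [exp_weight_mul, exp_weight_mul, hp', sub_self, zero_mul, Real.exp_zero, one_mul, one_mul]
    rfl
  have e1' := sum_filter_qType d a r (fun μ m =>
      ((r * (t ^ m * csT b t μ) + (((m : ℝ) * t ^ (m - 1) * csT b t μ + t ^ m * csD b t μ)))
          • curl (csΦ (fun k => ψ k m) (fun k => χ k m) μ) x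
        - (t ^ m * csT b t μ) • (Δ (curl (csΦ (fun k => ψ k m) (fun k => χ k m) μ))) x))
  rw [e1, e1']
  refine Finset.sum_congr rfl fun k hk => ?_
  have hk' : a k = r := (Finset.mem_filter.1 hk).2
  -- per rate: split off the Jordan coupling and reindex it
  set V : ℕ → E3 := fun m => Real.cos (b k * t) • curl (ψ k m) x + Real.sin (b k * t) • curl (χ k m) x
    with hV
  have hVd : V d = 0 := by
    simp only [hV, hψd k d le_rfl, hχd k d le_rfl]
    have : curl (0 : E3 → E3) x = 0 := curl_zero x
    rw [this, smul_zero, smul_zero, add_zero]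
  have e2 : ∀ m : ℕ,
      ((r * (t ^ m * csT b t (Sum.inl k))
          + ((m : ℝ) * t ^ (m - 1) * csT b t (Sum.inl k) + t ^ m * csD b t (Sum.inl k)))
          • curl (csΦ (fun k => ψ k m) (fun k => χ k m) (Sum.inl k)) x
        - (t ^ m * csT b t (Sum.inl k))
          • (Δ (curl (csΦ (fun k => ψ k m) (fun k => χ k m) (Sum.inl k)))) x)
      + ((r * (t ^ m * csT b t (Sum.inr k))
          + ((m : ℝ) * t ^ (m - 1) * csT b t (Sum.inr k) + t ^ m * csD b t (Sum.inr k)))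
          • curl (csΦ (fun k => ψ k m) (fun k => χ k m) (Sum.inr k)) x
        - (t ^ m * csT b t (Sum.inr k))
          • (Δ (curl (csΦ (fun k => ψ k m) (fun k => χ k m) (Sum.inr k)))) x)
      = t ^ m • (Real.cos (b k * t) • (a k • curl (ψ k m) x + b k • curl (χ k m) x
            - (Δ (curl (ψ k m))) x)
          + Real.sin (b k * t) • (a k • curl (χ k m) x - b k • curl (ψ k m) x
            - (Δ (curl (χ k m))) x))
        + ((m : ℝ) * t ^ (m - 1)) • V m := by
    intro m
    simp only [csT_inl, csT_inr, csD_inl, csD_inr, csΦ_inl, csΦ_inr, hV, hk']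
    module
  rw [Finset.sum_congr rfl fun m _ => e2 m, Finset.sum_add_distrib,
    sum_range_deriv_reindex d V hVd t, ← Finset.sum_add_distrib]
  refine Finset.sum_congr rfl fun m _ => ?_
  simp only [hV, qX_apply, qY_apply]
  module

/-- **Row A1qx — Jordan ⊗ oscillation cell, the full explicit quasi-polynomial (KERNEL-DECIDED here:
Liouville holds on the row).**  Slices of the exact shape produced by a real constant-coefficient
linear ODE in time acting on finitely many spatial profiles:
`u(t,x) = Σₖ e^{aₖt} Σ_{m<d} t^m (cos(bₖt) ψₖₘ(x) + sin(bₖt) χₖₘ(x))` with pairwise distinct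
exponents `aₖ + i bₖ` (`bₖ ≥ 0`), `C³` profiles with bounded curls.  Then a Type-I ancient mild
solution of this shape vanishes.  Contains `Row_A1cs` (`d = 1`) and `Row_A1jb` (one real rate).
MECHANISM: (i) real parts `≤ 0` carry no velocity (exponential weights beat polynomial ones, then
quasi-polynomial independence at `-∞`: divide by the top power of `t`, separate the finitely many
frequencies with the second difference `f(t+τ)+f(t-τ)-2cos(βτ)f(t)`, descend in the power);
(ii) in the vorticity equation the linear group of the smallest vorticity-carrying real part `r > 0`
dominates the quadratic remainder at `-∞`; its `t^m cos / t^m sin` coefficients vanish, which is the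
triangular system `Δωᶜₘ = r ωᶜₘ + b ωˢₘ + (m+1) ωᶜₘ₊₁`, `Δωˢₘ = r ωˢₘ - b ωᶜₘ + (m+1) ωˢₘ₊₁`;
JORDAN DESCENT from the top power through the rotating shell system (`b ≠ 0`) or the positive
shell (`b = 0`) kills every `ωₘ`; (iii) KNSS gauge. -/
def Row_A1qx : Prop :=
  ∀ (C : ℝ) (u : ℝ → E3 → E3), IsTypeIAncientMild C u →
  ∀ (n d : ℕ) (a b : Fin n → ℝ) (ψ χ : Fin n → ℕ → E3 → E3),
    (∀ k, 0 ≤ b k) → Function.Injective (fun k => (a k, b k)) →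
    (∀ k m, ContDiff ℝ 3 (ψ k m)) → (∀ k m, ContDiff ℝ 3 (χ k m)) →
    (∀ k m, ∃ A : ℝ, ∀ x, ‖curl (ψ k m) x‖ ≤ A) → (∀ k m, ∃ A : ℝ, ∀ x, ‖curl (χ k m) x‖ ≤ A) →
    (∀ t < 0, ∀ x, u t x = ∑ k, ∑ m ∈ Finset.range d, (Real.exp (a k * t) * t ^ m) •
        (Real.cos (b k * t) • ψ k m x + Real.sin (b k * t) • χ k m x)) →
    ∀ t < 0, ∀ x, u t x = 0

end Summit.NavierStokesRegularity.NavierStokesRegularity.Theorems.ScenarioCensus.TemporalSpectrum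

end
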